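import Literature.NumberTheory.EllipticCurves.BurungaleCastellaSkinner2025.BDPMainConjectureAtTrivialCharacter
import HarnessLib

/-!
# Burungale–Castella–Skinner 2025, Thm. 1.2.4 (a) (the anticyclotomic BDP main conjecture for
# `X_Gr(E/K_∞⁻)` RATIONALLY, in `Λ⁻,ur ⊗ ℚ_p`, under (irr_ℚ) ONLY) + Prop. 4.2.2 (`μ(L_p^BDP) = 0`,
# Hsieh) AT THE TRIVIAL CHARACTER, combined with Castella–Grossi–Lee–Skinner 2022 Thm. 5.1.3 (the
# BDP formula): `𝓕(0) = u · p^k · c_E⁻² (1 − a_p p⁻¹ + p⁻¹)² log_{ω_E}(P_K)²` with `k ≥ 0` — the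
# IRREDUCIBLE-NON-SURJECTIVE twin of `BDPMainConjectureAtTrivialCharacter.lean` (which needs (sur))

HONEST FRAMING. This file TYPES a composite of three PUBLISHED theorems as ONE named fact
(`def … : Prop`, nothing asserted, no `_holds`; D-0014/D-0026) in the tree's EXISTING vocabulary
(the Literature object `Castella2018.AcSelmer.XAc` and the log reading of `PadicFormalLogOrder.lean`,
exactly as its (sur)-sibling `thm124b_thm513_generator_constantCoeff`), and proves only bookkeeping
consumers. Typed ≠ proved ≠ endorsed. Written by the prover seat `bsd-print-x9-p4` of cell
`run/shared/lean/pub/bsd-print-x9/` (D-0131 print tier, class X9 = irreducible NON-surjective image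
at a good ordinary `p ∈ {5, 7}`): on that class hypothesis (sur) of Thm. 1.2.4 (b) FAILS, and this is
the printed substitute — ONE-SIDED (a lower bound on `ord_p 𝓕(0)`), which is exactly the direction
the rank-one `p`-part of BSD consumes (STEP L of Jetchev–Skinner–Wan §7.4.1: a LOWER bound on
`#Ш(E/K)[p^∞]`; the cell's Summits predicate `X11b.IMCLowerWaldspurgerOnTreeGoodAt`).

## Sources (read on the store's text `paper:arxiv-2405.00270` = arXiv:2405.00270v2, 12 pp., and
## the CGLS TeX quoted in `CastellaGrossiLeeSkinner2022/BDPValueAtTrivialCharacter.lean`)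

* **[BurungaleCastellaSkinner2025]** A. Burungale, F. Castella, C. Skinner, *Base change and Iwasawa
  main conjectures for GL₂*, Int. Math. Res. Not. IMRN **2025**, no. 8, rnaf082
  (doi:10.1093/imrn/rnaf082) = arXiv:2405.00270v2. REFEREED / PUBLISHED.
  Setting of §1.2 (p. 2 bottom – p. 3; `[p0002 L40–L50, p0003 L1–L35]`, verbatim): "Assume that the
  discriminant `D_K < 0` satisfies `D_K` is odd and `D_K ≠ −3`. (disc) Moreover, assume that `K`
  satisfies the Heegner hypothesis, namely every prime `ℓ | N` splits in `K`, (Heeg) and that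
  `p = v v̄` splits in `K` (spl) for `v` the prime of `K` above `p` induced by an embedding
  `ℚ̄ ↪ ℚ̄_p`, which we fix throughout"; data of Thm. 1.2.2: "Let `E` be an elliptic curve defined
  over `ℚ` of conductor `N`, `p` be a prime of good ordinary reduction for `E`, and `K` an imaginary
  quadratic field satisfying (disc), (Heeg), and (spl)"; p. 3: "`L_p^BDP(E/K) ∈ Λ_K^{−,ur}`
  constructed in [BDP13] (see [CH18]) generates the characteristic ideal of the anticyclotomic Selmer
  group `X_Gr(E/K_∞⁻)` whose classes are locally trivial (resp. unrestricted) at the primes above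
  `v̄` (resp. `v`). Here we put `Λ_K^{−,ur} = Λ_K⁻ ⊗̂_{ℤ_p} ℤ_p^ur`".
  **Theorem 1.2.4 (a)** (p. 3, `[p0003 L86–L95]`, verbatim): "Let `(E, p, K)` be as in Theorem 1.2.2.
  (a) If `p > 3` satisfies (irr_ℚ), then `X_Gr(E/K_∞⁻)` is `Λ_K⁻`-torsion, and
  `ch_{Λ_K⁻}(X_Gr(E/K_∞⁻)) = (L_p^BDP(E/K))` in `Λ_K^{−,ur} ⊗ ℚ_p`." ((irr_ℚ) = "`E[p]` is an
  irreducible `G_ℚ`-module", p. 2 L4.) Proof: p. 11 ("Proof of Theorem 1.2.2 and Theorem 1.2.4").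
  **Proposition 4.2.2** (pp. 8–9, `[p0009 L2–L8]`, verbatim): "Let `g ∈ S₂(Γ₀(N))` be an elliptic
  newform with good reduction at `p > 2`, and suppose `K` is an imaginary quadratic field satisfying
  (disc), (Heeg), (spl), and (irr_K). Then `μ(L_p^Gr(g/K)) = μ(L_p^BDP(g/K)) = 0`. *Proof.* By
  [Hsi14, Thm. B], `L_p^BDP(g/K)` has vanishing `μ`-invariant. …" ((irr_K) = "`ρ̄_g` is irreducible
  as `G_K`-representation", p. 7.)
  The proof of Cor. 1.3.1 (`r = 1`, p. 4): "the result in the case `r = 1` follows from Theorem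
  1.2.4, the `p`-adic Waldspurger formula [BDP13] for the value of `L_p^BDP(E/K)` at the trivial
  character, the anticyclotomic control theorem [JSW17, Thm. 3.3.1], and the `r = 0` result for the
  `K`-quadratic twist of `E`".
* **[CastellaGrossiLeeSkinner2022]** Invent. Math. **227** (2022), **Thm. 5.1.3** (verbatim, data of
  §5.1.2: `E/ℚ` of conductor `N`, `π : X₀(N) → E`, `K` with the Heegner hypothesis relative to `N`,
  `P_K = Σ_σ π(x₁)^σ ∈ E(K)`, `c_E` the Manin constant, `π^*(ω_E) = c_E ω_f`): "let `p > 2` be a prime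
  of good reduction for `E` such that `p = v v̄` splits in `K`. Then
  `𝓛_E(0) = c_E⁻² · (1 − a_p p⁻¹ + p⁻¹)² · log_{ω_E}(P_K)²`" (`𝓛_E = L_p^BDP(E/K)`: same construction,
  [CH18, Prop. 3.8] = [CGLS, Thm. 2.1.1]). No image hypothesis (BDP13 Thm. 5.13 at `k = 2`).
* **[Hsieh2014]** M.-L. Hsieh, Doc. Math. **19** (2014), Thm. B — the source of Prop. 4.2.2 as cited
  by BCS (tree files `Hsieh2014/AnticyclotomicMuInvariant*.lean`).

## The composite, and the two-line `μ`-comparison that assembles it (recorded for the referee)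

Write `Λ = Λ_K⁻`, `R = Λ_K^{−,ur}` (a domain), `𝓕 ∈ Λ` a generator of the principal ideal
`ch_Λ(X_Gr(E/K_∞⁻))` (torsion by Thm. 1.2.4 (a)), `L = L_p^BDP(E/K) ∈ R`. Thm. 1.2.4 (a): there are
`a, b ≥ 0` and `w ∈ R^×` with `p^a · 𝓕 = w · p^b · L` in `R` ("equality in `R ⊗ ℚ_p`"). Prop. 4.2.2:
`μ(L) = 0`. Taking `μ`-invariants (additive, `μ(p) = 1`, `μ(w) = 0`, `μ(𝓕) ≥ 0`):
`a + μ(𝓕) = b + μ(L) = b`, so `b − a = μ(𝓕) =: k ∈ ℕ` and, `R` being a domain, `𝓕 = w · p^k · L`.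
At the trivial character: `𝓕(0) = w(0) · p^k · L(𝟙)` with `w(0) ∈ (ℤ_p^ur)^×`, and by CGLS Thm.
5.1.3 `L(𝟙) = c_E⁻² (1 − a_p p⁻¹ + p⁻¹)² log_{ω_E}(P_K)² ∈ K_v = ℚ_p`; so
**`𝓕(0) = u · p^k · c_E⁻² (1 − a_p p⁻¹ + p⁻¹)² log_{ω_E}(P_K)²` with `u ∈ ℚ_p ∩ (ℤ_p^ur)^× = ℤ_p^×`
and `k ∈ ℕ`** (when the value is `0`, i.e. `P_K` torsion, `u := 1`, `k := 0` serve). In valuations: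
`ord_p 𝓕(0) = k + 2·(ord_p(1 − a_p + p) − 1 + ord_p log_{ω_E} P_K) − 2·ord_p c_E ≥` the same with
`k = 0` — i.e. `L_p^BDP(E/K) ∣ 𝓕` INTEGRALLY in `R` (the (irr_ℚ)-half of Conj. 1.2.1 that survives
without (sur)), read at `𝟙`. Under (sur) Thm. 1.2.4 (b) gives `k = 0` (the sibling fact).
REFEREE FLAG offered with this fact (travels with it): `BCS25-124a+422-mu-composite` — the displayed
identity is not printed as such by BCS; it is the three printed statements assembled by the
`μ`-comparison above (two lines of commutative algebra in `ℤ_p^ur⟦T⟧`). Inherited provenance flag: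
`BCS25-IMC-equiv@BSTW` (Thm. 1.2.4's printed proof passes through [BSTW23] = arXiv:2409.01350, a
preprint input of a published theorem; Prop. 4.2.2 and CGLS 5.1.3 do not). Reading flag inherited
from the sibling: `BCS-124-XGr-reading` (BCS §2.1's formal Greenberg condition at `w ∣ v̄` is
"unramified"; the Introduction's "locally trivial", = CGLS22's `𝔛_E`, is the tree object).

## Transcription (tree vocabulary; binders = the sibling `thm124b_thm513_generator_constantCoeff`'s,
## with `Surj W p` REPLACED by `Irr W p` and the (irr_K) binder of Prop. 4.2.2 ADDED)

* "`E/ℚ` of conductor `N`, `p > 3` good ordinary, (irr_ℚ)" = a globally minimal `W`, `3 < p`,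
  `GoodOrd W p`, `Irr W p` (the cell's `Rank1Residual` predicates); (irr_K) =
  `(W.baseChange K).HasIrreducibleModPGaloisRep p` (for `K` quadratic with `(d_K, N) = 1` — automatic
  under (Heeg) — and `p ≠ 2` it FOLLOWS from (irr_ℚ): Matar–Nekovář 2019 Prop. 5.26 (2), tree fact
  `MatarNekovar2019.prop526_hasIrreducibleModPGaloisRep_baseChange`; kept as a binder, as printed).
* `K`: `IsImaginaryQuadratic K`; (Heeg) `SatisfiesHeegnerHypothesis (W.conductorNorm ℤ) K`; (spl)
  `SatisfiesHeegnerHypothesis p K`; (disc) `Odd (discr K) ∧ discr K ≠ -3`.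
* "`v` induced by the fixed embedding, `v̄`", "`Γ⁻`, `γ`, `Λ⁻`", "`X_Gr(E/K_∞⁻)`": EXACTLY the
  sibling's binders: `ι : K →+* ℚ_[p]`, `v` with `x ∈ v ⟺ ‖ι x‖ < 1`, `vbar ∋ p`, `vbar ≠ v`; `κ`
  anticyclotomic with topological generator `γ`; `X_Gr(E/K_∞⁻) = AcSelmer.XAc (W.baseChange K) p κ
  vbar ∅ γ`.
* "`π`, `c_E`, `P_K`, `log_{ω_E}(P_K)`": EXACTLY the sibling's `(Dt, H, ιC, P)` and
  `log_W(z(m₀ • P_ι))/m₀` (`padicLogPoint`, `formalIndex`, `padicPointOf`).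
* Conclusion: `X_Gr` is `Λ`-torsion and there is a generator `F` of `ch_Λ(X_Gr)`, a unit
  `u ∈ ℤ_p^×` and `k : ℕ` with `F(0) = u · p^k · c_E⁻² · (1 − a_p p⁻¹ + p⁻¹)² · log_{ω_E}(P_K)²` in
  `ℚ_p`. COMPOSITE OF THREE PRINTED, PUBLISHED THEOREMS; WEAKER than their conjunction (only the
  value at `𝟙` of the divisibility `L ∣ 𝓕` is kept); nothing asserted.

## Contents

* `thm124a_prop422_thm513_generator_constantCoeff` — the named fact (ONE new `def … : Prop`).
* PROVED: `generator_constantCoeff_eq_of_thm124a`, `le_valuation_generator_constantCoeff_of_thm124a`,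
  `hasCharValuationAt_ge_of_thm124a` (the packaged shape `∃ n, AcSelmer.XAc.HasCharValuationAt … n ∧
  2·(ord_p(1 − a_p + p) − 1 + ord_p log_{ω_E} P_K) − 2·ord_p c_E ≤ n` — LITERALLY the body of the
  Summits predicate `X11b.IMCLowerWaldspurgerOnTreeGoodAt p κ vbar γ ι P` up to the Manin term).

## References
* [BurungaleCastellaSkinner2025] IMRN 2025 rnaf082 = arXiv:2405.00270v2: §1.2 (setting), Thm. 1.2.4 (a),
  Prop. 4.2.2 (pp. 8–9), proof of Cor. 1.3.1 (p. 4), §5 (proof, p. 11).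
* [CastellaGrossiLeeSkinner2022] Invent. Math. 227 (2022): Thm. 5.1.3 with §5.1.2; Thm. 2.1.1.
* [Hsieh2014] Doc. Math. 19 (2014), Thm. B. [BertoliniDarmonPrasanna2013] Duke Math. J. 162: Thm. 5.13.
* [MatarNekovar2019] JTNB 31 (2019), Prop. 5.26 (2) (the (irr_K) binder from (irr_ℚ)).
* Tree: the sibling `BDPMainConjectureAtTrivialCharacter.lean` ((sur) case, `k = 0`),
  `BDPMainConjecture.lean` (Thm. 1.2.4 (a)/(b), Prop. 4.2.2 as statements about the ideal / the frame),
  `CastellaGrossiLeeSkinner2022/BDPValueAtTrivialCharacter.lean` (A173, the Eisenstein twin).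
-/

set_option autoImplicit false

noncomputable section

open scoped Classical

open WeierstrassCurve NumberField IsDedekindDomain Field Literature.NumberTheory.EllipticCurves
  Literature.NumberTheory.EllipticCurves.ModularForms Literature.NumberTheory.QuadraticFields
  Literature.NumberTheory.EllipticCurves.Rank1Residual
  Literature.NumberTheory.EllipticCurves.Castella2018

namespace Literature.NumberTheory.EllipticCurves.BurungaleCastellaSkinner2025

/-- **Burungale–Castella–Skinner, IMRN 2025 (rnaf082) = arXiv:2405.00270v2, Theorem 1.2.4 (a) and
Proposition 4.2.2 at the trivial character, combined with Castella–Grossi–Lee–Skinner, Invent. Math.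
227 (2022) Theorem 5.1.3 (the Bertolini–Darmon–Prasanna formula).** Thm. 1.2.4 (verbatim; data of
Thm. 1.2.2: "`E` an elliptic curve defined over `ℚ` of conductor `N`, `p` a prime of good ordinary
reduction for `E`, and `K` an imaginary quadratic field satisfying (disc) [`D_K` odd, `D_K ≠ −3`],
(Heeg) [every `ℓ ∣ N` splits in `K`], and (spl) [`p = v v̄` splits, `v` induced by the fixed embedding
`ℚ̄ ↪ ℚ̄_p`]"): "(a) If `p > 3` satisfies (irr_ℚ), then `X_Gr(E/K_∞⁻)` is `Λ_K⁻`-torsion, and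
`ch_{Λ_K⁻}(X_Gr(E/K_∞⁻)) = (L_p^BDP(E/K))` in `Λ_K^{−,ur} ⊗ ℚ_p`." Prop. 4.2.2 (verbatim): "Let
`g ∈ S₂(Γ₀(N))` be an elliptic newform with good reduction at `p > 2`, and suppose `K` is an
imaginary quadratic field satisfying (disc), (Heeg), (spl), and (irr_K). Then `μ(L_p^Gr(g/K)) =
μ(L_p^BDP(g/K)) = 0`." CGLS Thm. 5.1.3 (verbatim, data of §5.1.2): "let `p > 2` be a prime of good
reduction for `E` such that `p = v v̄` splits in `K`. Then `𝓛_E(0) = c_E⁻² · (1 − a_p p⁻¹ + p⁻¹)² ·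
log_{ω_E}(P_K)²`". COMBINED at the trivial character by the `μ`-comparison of the module docstring
(`p^a 𝓕 = w p^b L`, `μ(L) = 0` ⟹ `𝓕 = w · p^{μ(𝓕)} · L` in `Λ^{−,ur}`): a generator `𝓕 ∈ Λ` of
`ch(X_Gr(E/K_∞⁻))` satisfies `𝓕(0) = u · p^k · c_E⁻² (1 − a_p p⁻¹ + p⁻¹)² log_{ω_E}(P_K)²` for some
`u ∈ ℤ_p^×` and `k ∈ ℕ` (`k = μ(𝓕)`; an identity in `K_v = ℚ_p`). TRANSCRIBED (module docstring for
the dictionary): `W` globally minimal, `3 < p`, `GoodOrd W p`, `Irr W p`; `K` imaginary quadratic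
with (Heeg) for `N_E`, (spl), (disc) `D_K` odd `≠ −3`, (irr_K) `(W.baseChange K).HasIrreducibleModPGaloisRep p`;
`(ι, v, vbar, κ, γ)` and `X_Gr(E/K_∞⁻) = AcSelmer.XAc (W.baseChange K) p κ vbar ∅ γ` exactly as in
the sibling `thm124b_thm513_generator_constantCoeff` (strict at `v̄`, relaxed at `v`;
`K_∞`-formulation; reading flag `BCS-124-XGr-reading`); `(Dt, H, ιC, P)` and
`log_{ω_E}(P_K) = log_W(z(m₀ • P_ι))/m₀` exactly as there; conclusion: `X_Gr` is `Λ`-torsion and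
there is a generator `F` of `ch_Λ(X_Gr)`, `u ∈ ℤ_p^×` and `k : ℕ` with `F(0) = u · p^k · c_E⁻² ·
(1 − a_p p⁻¹ + p⁻¹)² · log_{ω_E}(P_K)²` in `ℚ_p`. COMPOSITE OF THREE PRINTED, PUBLISHED THEOREMS
(flag `BCS25-124a+422-mu-composite`; inherited `BCS25-IMC-equiv@BSTW`); nothing asserted.
[cite: BurungaleCastellaSkinner2025, Thm. 1.2.4 (a) (§1.2, p. 3; arXiv:2405.00270v2 p0003 L86–L95) with the setting of §1.2 (pp. 2–3), Prop. 4.2.2 (pp. 8–9; p0009 L2–L8) and the proof of Cor. 1.3.1 (p. 4)]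
[cite: CastellaGrossiLeeSkinner2022, Thm. 5.1.3 (TeX `thmpadicGZ`, L2463–L2471) with §5.1.2 (L2434–L2447)]
[cite: Hsieh2014, Thm. B (the source of Prop. 4.2.2, as cited by BCS)]
[cite: BertoliniDarmonPrasanna2013, Thm. 5.13 (the source of Thm. 5.1.3)] -/
def thm124a_prop422_thm513_generator_constantCoeff : Prop :=
  ∀ (W : WeierstrassCurve ℚ) [W.IsElliptic] [W.IsGloballyMinimal] (p : ℕ) [Fact p.Prime],
    3 < p → GoodOrd W p → Irr W p →
    ∀ (K : Type) [Field K] [NumberField K], IsImaginaryQuadratic K →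
      SatisfiesHeegnerHypothesis (W.conductorNorm ℤ) K → SatisfiesHeegnerHypothesis p K →
      Odd (NumberField.discr K) → NumberField.discr K ≠ -3 →
      (W.baseChange K).HasIrreducibleModPGaloisRep p →
    ∀ (ι : K →+* ℚ_[p]) (v vbar : HeightOneSpectrum (𝓞 K)),
      (∀ x : 𝓞 K, x ∈ v.asIdeal ↔ ‖ι (x : K)‖ < 1) →
      ((p : ℕ) : 𝓞 K) ∈ vbar.asIdeal → vbar ≠ v →
    ∀ (κ : ZpExtension K p), κ.IsAnticyclotomic →
    ∀ (γ : absoluteGaloisGroup K) [Fact (κ.IsTopGenerator γ)],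
    ∀ (N : ℕ) [NeZero N] (Dt : ModularParametrizationData W N)
      (H : HeegnerDatum N (NumberField.discr K)) (ιC : K →+* ℂ) (P : (W.baseChange K).toAffine.Point),
      WeierstrassCurve.Affine.Point.map ιC.toRatAlgHom P = heegnerPointComplex Dt H →
      Module.IsTorsion (IwasawaAlgebra p) (AcSelmer.XAc (W.baseChange K) p κ vbar ∅ γ) ∧
      ∃ F : IwasawaAlgebra p,
        AcSelmer.XAc.charIdeal (W.baseChange K) p κ vbar ∅ γ = Ideal.span {F} ∧
        ∃ (u : ℤ_[p]ˣ) (k : ℕ),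
          ((PowerSeries.constantCoeff F : ℤ_[p]) : ℚ_[p]) =
            ((u : ℤ_[p]) : ℚ_[p]) * (p : ℚ_[p]) ^ k * ((Dt.c : ℚ_[p])⁻¹) ^ 2 *
              (1 - (W.frobeniusTrace p : ℚ_[p]) * (p : ℚ_[p])⁻¹ + (p : ℚ_[p])⁻¹) ^ 2 *
              ((W.baseChange ℚ_[p]).padicLogPoint (formalIndex W p • padicPointOf W p ι P) /
                (formalIndex W p : ℚ_[p])) ^ 2

/-! ### A `p`-adic valuation computation (standard API; no mathematical content of its own) -/

section Valuation

variable {p : ℕ} [hp : Fact p.Prime]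

/-- `ord_p` of the right-hand side of (1.2.4 (a) + 4.2.2) ∘ Thm. 5.1.3: for a unit `u ∈ ℤ_p^×`,
`k ∈ ℕ`, integers `c, a`, `L ∈ ℚ_p` and `m ∈ ℕ`, if `u · p^k · c⁻² · (1 − a p⁻¹ + p⁻¹)² · (L/m)² ≠ 0`
then its valuation is `k + 2·(ord_p(1 − a + p) − 1 + (ord_p L − ord_p m)) − 2·ord_p c` (each factor is
non-zero, `ord_p` is additive, `1 − a p⁻¹ + p⁻¹ = (1 − a + p)/p`). Private helper. [folklore] -/
private theorem valuation_unit_mul_pow_mul_bdpShape (u : ℤ_[p]ˣ) (k : ℕ) (c a : ℤ) (L : ℚ_[p])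
    (m : ℕ)
    (h : ((u : ℤ_[p]) : ℚ_[p]) * (p : ℚ_[p]) ^ k * ((c : ℚ_[p])⁻¹) ^ 2 *
        (1 - (a : ℚ_[p]) * (p : ℚ_[p])⁻¹ + (p : ℚ_[p])⁻¹) ^ 2 * (L / (m : ℚ_[p])) ^ 2 ≠ 0) :
    (((u : ℤ_[p]) : ℚ_[p]) * (p : ℚ_[p]) ^ k * ((c : ℚ_[p])⁻¹) ^ 2 *
        (1 - (a : ℚ_[p]) * (p : ℚ_[p])⁻¹ + (p : ℚ_[p])⁻¹) ^ 2 * (L / (m : ℚ_[p])) ^ 2).valuation =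
      (k : ℤ) + 2 * ((padicValInt p (1 - a + p) : ℤ) - 1 + (L.valuation - (padicValNat p m : ℤ))) -
        2 * (padicValInt p c : ℤ) := by
  have hp0 : (p : ℚ_[p]) ≠ 0 := by exact_mod_cast hp.out.ne_zero
  have hu0 : ((u : ℤ_[p]) : ℚ_[p]) ≠ 0 := PadicInt.coe_ne_zero.2 u.ne_zero
  have hpk0 : (p : ℚ_[p]) ^ k ≠ 0 := pow_ne_zero k hp0
  have hc0 : ((c : ℚ_[p])⁻¹) ≠ 0 := by
    intro h0; apply h; rw [h0]; ring
  have hA0 : (1 - (a : ℚ_[p]) * (p : ℚ_[p])⁻¹ + (p : ℚ_[p])⁻¹) ≠ 0 := by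
    intro h0; apply h; rw [h0]; ring
  have hLm0 : L / (m : ℚ_[p]) ≠ 0 := by
    intro h0; apply h; rw [h0]; ring
  have hL0 : L ≠ 0 := by
    intro h0; apply hLm0; rw [h0, zero_div]
  have hm0 : (m : ℚ_[p]) ≠ 0 := by
    intro h0; apply hLm0; rw [h0, div_zero]
  -- `1 − a p⁻¹ + p⁻¹ = (1 − a + p)/p`
  have hAeq : (1 - (a : ℚ_[p]) * (p : ℚ_[p])⁻¹ + (p : ℚ_[p])⁻¹) =
      ((1 - a + p : ℤ) : ℚ_[p]) * (p : ℚ_[p])⁻¹ := by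
    push_cast
    field_simp
    ring
  have hA1 : ((1 - a + p : ℤ) : ℚ_[p]) ≠ 0 := by
    intro h0; apply hA0; rw [hAeq, h0, zero_mul]
  -- valuations of the five factors
  have hvu : ((u : ℤ_[p]) : ℚ_[p]).valuation = 0 := by
    simp only [PadicInt.valuation_coe, padicInt_valuation_eq_zero_of_isUnit u.isUnit, Nat.cast_zero]
  have hvpk : ((p : ℚ_[p]) ^ k).valuation = (k : ℤ) := by
    rw [Padic.valuation_pow, Padic.valuation_p]
    ring
  have hvc : ((c : ℚ_[p])⁻¹).valuation = -(padicValInt p c : ℤ) := by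
    rw [Padic.valuation_inv, Padic.valuation_intCast]
  have hvA : (1 - (a : ℚ_[p]) * (p : ℚ_[p])⁻¹ + (p : ℚ_[p])⁻¹).valuation =
      (padicValInt p (1 - a + p) : ℤ) - 1 := by
    rw [hAeq, Padic.valuation_mul hA1 (inv_ne_zero hp0), Padic.valuation_intCast,
      Padic.valuation_inv, Padic.valuation_p]
    ring
  have hvL : (L / (m : ℚ_[p])).valuation = L.valuation - (padicValNat p m : ℤ) := by
    rw [div_eq_mul_inv, Padic.valuation_mul hL0 (inv_ne_zero hm0), Padic.valuation_inv,
      Padic.valuation_natCast]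
    ring
  rw [Padic.valuation_mul (mul_ne_zero (mul_ne_zero (mul_ne_zero hu0 hpk0) (pow_ne_zero 2 hc0))
      (pow_ne_zero 2 hA0)) (pow_ne_zero 2 hLm0),
    Padic.valuation_mul (mul_ne_zero (mul_ne_zero hu0 hpk0) (pow_ne_zero 2 hc0)) (pow_ne_zero 2 hA0),
    Padic.valuation_mul (mul_ne_zero hu0 hpk0) (pow_ne_zero 2 hc0), Padic.valuation_mul hu0 hpk0, hvpk,
    Padic.valuation_pow, Padic.valuation_pow, Padic.valuation_pow, hvu, hvc, hvA, hvL]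
  ring

end Valuation

variable {W : WeierstrassCurve ℚ} [W.IsElliptic] [W.IsGloballyMinimal] {p : ℕ} [Fact p.Prime]

/-! ### Bookkeeping consumers -/

/-- **Every generator satisfies the identity (with its own unit and the SAME exponent `k`).**
Granted the fact, if `ch_Λ(X_Gr) = (𝓖)` for ANY `𝓖 ∈ Λ`, then `𝓖(0) = u' · p^k · c_E⁻² (1 − a_p p⁻¹
+ p⁻¹)² log_{ω_E}(P_K)²` for some `u' ∈ ℤ_p^×`, `k ∈ ℕ` (two generators of a principal ideal of the
domain `Λ = ℤ_p⟦T⟧` differ by a unit of `Λ`, whose constant term is a unit of `ℤ_p`).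
[cite: BurungaleCastellaSkinner2025, Thm. 1.2.4 (a) (p. 3), Prop. 4.2.2 (pp. 8–9)] -/
theorem generator_constantCoeff_eq_of_thm124a (h : thm124a_prop422_thm513_generator_constantCoeff)
    (hp : 3 < p) (hord : GoodOrd W p) (hirr : Irr W p)
    (K : Type) [Field K] [NumberField K] (hK : IsImaginaryQuadratic K)
    (hHN : SatisfiesHeegnerHypothesis (W.conductorNorm ℤ) K) (hHp : SatisfiesHeegnerHypothesis p K)
    (hodd : Odd (NumberField.discr K)) (h3 : NumberField.discr K ≠ -3)
    (hirrK : (W.baseChange K).HasIrreducibleModPGaloisRep p)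
    (ι : K →+* ℚ_[p]) (v vbar : HeightOneSpectrum (𝓞 K))
    (hv : ∀ x : 𝓞 K, x ∈ v.asIdeal ↔ ‖ι (x : K)‖ < 1)
    (hvbar : ((p : ℕ) : 𝓞 K) ∈ vbar.asIdeal) (hne : vbar ≠ v)
    (κ : ZpExtension K p) (hκ : κ.IsAnticyclotomic)
    (γ : absoluteGaloisGroup K) [Fact (κ.IsTopGenerator γ)]
    {N : ℕ} [NeZero N] (Dt : ModularParametrizationData W N)
    (H : HeegnerDatum N (NumberField.discr K)) (ιC : K →+* ℂ) (P : (W.baseChange K).toAffine.Point)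
    (hP : WeierstrassCurve.Affine.Point.map ιC.toRatAlgHom P = heegnerPointComplex Dt H)
    (G : IwasawaAlgebra p) (hG : AcSelmer.XAc.charIdeal (W.baseChange K) p κ vbar ∅ γ = Ideal.span {G}) :
    ∃ (u' : ℤ_[p]ˣ) (k : ℕ),
      ((PowerSeries.constantCoeff G : ℤ_[p]) : ℚ_[p]) =
        ((u' : ℤ_[p]) : ℚ_[p]) * (p : ℚ_[p]) ^ k * ((Dt.c : ℚ_[p])⁻¹) ^ 2 *
          (1 - (W.frobeniusTrace p : ℚ_[p]) * (p : ℚ_[p])⁻¹ + (p : ℚ_[p])⁻¹) ^ 2 *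
          ((W.baseChange ℚ_[p]).padicLogPoint (formalIndex W p • padicPointOf W p ι P) /
            (formalIndex W p : ℚ_[p])) ^ 2 := by
  obtain ⟨-, F, hF, u, k, hu⟩ :=
    h W p hp hord hirr K hK hHN hHp hodd h3 hirrK ι v vbar hv hvbar hne κ hκ γ N Dt H ιC P hP
  -- `G = F · w` for a unit `w` of `Λ`; `w(0)` is a unit of `ℤ_p`
  obtain ⟨w, rfl⟩ := Ideal.span_singleton_eq_span_singleton.mp (hF.symm.trans hG)
  have hw : IsUnit (PowerSeries.constantCoeff (w : IwasawaAlgebra p)) :=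
    PowerSeries.isUnit_constantCoeff _ w.isUnit
  refine ⟨u * hw.unit, k, ?_⟩
  rw [map_mul, PadicInt.coe_mul, hu, Units.val_mul, PadicInt.coe_mul, IsUnit.unit_spec]
  ring

/-- **The identity in valuations, as a ONE-SIDED bound** — the currency of the control facts (A170,
JSW 3.3.1) and of the cell's `AcSelmer.XAc.HasCharValuationAt`: granted the fact, for EVERY generator
`𝓖` of `ch_Λ(X_Gr)` with `𝓖(0) ≠ 0`,
`2·(ord_p(1 − a_p + p) − 1 + ord_p log_{ω_E} P_K) − 2·ord_p c_E ≤ ord_p 𝓖(0)` (the defect is the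
exponent `k = μ(𝓖) ≥ 0` of the fact), where `ord_p log_{ω_E} P_K = padicLogOrd W p ι P`. This is
"`L_p^BDP(E/K) ∣ 𝓖` in `Λ^{−,ur}`" read at the trivial character.
[cite: BurungaleCastellaSkinner2025, Thm. 1.2.4 (a) (p. 3) and Prop. 4.2.2 (pp. 8–9), with the proof of Cor. 1.3.1 (p. 4)]
[cite: CastellaGrossiLeeSkinner2022, Thm. 5.1.3] -/
theorem le_valuation_generator_constantCoeff_of_thm124a
    (h : thm124a_prop422_thm513_generator_constantCoeff)
    (hp : 3 < p) (hord : GoodOrd W p) (hirr : Irr W p)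
    (K : Type) [Field K] [NumberField K] (hK : IsImaginaryQuadratic K)
    (hHN : SatisfiesHeegnerHypothesis (W.conductorNorm ℤ) K) (hHp : SatisfiesHeegnerHypothesis p K)
    (hodd : Odd (NumberField.discr K)) (h3 : NumberField.discr K ≠ -3)
    (hirrK : (W.baseChange K).HasIrreducibleModPGaloisRep p)
    (ι : K →+* ℚ_[p]) (v vbar : HeightOneSpectrum (𝓞 K))
    (hv : ∀ x : 𝓞 K, x ∈ v.asIdeal ↔ ‖ι (x : K)‖ < 1)
    (hvbar : ((p : ℕ) : 𝓞 K) ∈ vbar.asIdeal) (hne : vbar ≠ v)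
    (κ : ZpExtension K p) (hκ : κ.IsAnticyclotomic)
    (γ : absoluteGaloisGroup K) [Fact (κ.IsTopGenerator γ)]
    {N : ℕ} [NeZero N] (Dt : ModularParametrizationData W N)
    (H : HeegnerDatum N (NumberField.discr K)) (ιC : K →+* ℂ) (P : (W.baseChange K).toAffine.Point)
    (hP : WeierstrassCurve.Affine.Point.map ιC.toRatAlgHom P = heegnerPointComplex Dt H)
    (G : IwasawaAlgebra p) (hG : AcSelmer.XAc.charIdeal (W.baseChange K) p κ vbar ∅ γ = Ideal.span {G})
    (hG0 : PowerSeries.constantCoeff G ≠ 0) :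
    2 * ((padicValInt p (1 - W.frobeniusTrace p + p) : ℤ) - 1 + padicLogOrd W p ι P) -
        2 * (padicValInt p Dt.c : ℤ) ≤ ((PowerSeries.constantCoeff G).valuation : ℤ) := by
  obtain ⟨u', k, hu'⟩ := generator_constantCoeff_eq_of_thm124a h hp hord hirr K hK hHN hHp hodd h3
    hirrK ι v vbar hv hvbar hne κ hκ γ Dt H ιC P hP G hG
  -- the left-hand side is non-zero, hence so is the right-hand side
  have hrhs : ((u' : ℤ_[p]) : ℚ_[p]) * (p : ℚ_[p]) ^ k * ((Dt.c : ℚ_[p])⁻¹) ^ 2 *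
      (1 - (W.frobeniusTrace p : ℚ_[p]) * (p : ℚ_[p])⁻¹ + (p : ℚ_[p])⁻¹) ^ 2 *
      ((W.baseChange ℚ_[p]).padicLogPoint (formalIndex W p • padicPointOf W p ι P) /
        (formalIndex W p : ℚ_[p])) ^ 2 ≠ 0 := by
    rw [← hu']
    exact PadicInt.coe_ne_zero.2 hG0
  have hval := congrArg Padic.valuation hu'
  rw [PadicInt.valuation_coe,
    valuation_unit_mul_pow_mul_bdpShape u' k Dt.c (W.frobeniusTrace p) _ _ hrhs] at hval
  rw [hval, padicLogOrd]
  omega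

/-- **Thm. 1.2.4 (a) + Prop. 4.2.2 ∘ Thm. 5.1.3 at the trivial character in the packaged currency**
`AcSelmer.XAc.HasCharValuationAt … n` ("`X_Gr` is `Λ`-torsion with a generator `𝓕`, `𝓕(0) ≠ 0`,
`ord_p 𝓕(0) = n`") `∧ 2·(ord_p(1 − a_p + p) − 1 + ord_p log_{ω_E} P_K) − 2·ord_p c_E ≤ n` — granted
the fact and ONE generator with non-zero constant term (at the cell's data this comes from a control
theorem: JSW Thm. 3.3.1, which needs (irr_K), NOT (sur)). Up to the Manin term `2·ord_p c_E` (absent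
for a parametrisation with `p ∤ c_E`) and the log-prime convention this is LITERALLY the body of the
cell's Summits predicate `X11b.IMCLowerWaldspurgerOnTreeGoodAt p κ vbar γ ι P` ((IMC≥∘BDP)ᵍ at `𝟙`),
now fed, at a good ordinary `p > 3` with (irr_ℚ) and WITHOUT (sur), by published facts.
[cite: BurungaleCastellaSkinner2025, Thm. 1.2.4 (a) (p. 3), Prop. 4.2.2 (pp. 8–9), proof of Cor. 1.3.1 (p. 4)]
[cite: CastellaGrossiLeeSkinner2022, Thm. 5.1.3] [cite: Castella2018, §5 (eq:IMC+BDP) (arXiv:1704.06608 p. 12) (the same shape at `p ∣ N`)] -/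
theorem hasCharValuationAt_ge_of_thm124a (h : thm124a_prop422_thm513_generator_constantCoeff)
    (hp : 3 < p) (hord : GoodOrd W p) (hirr : Irr W p)
    (K : Type) [Field K] [NumberField K] (hK : IsImaginaryQuadratic K)
    (hHN : SatisfiesHeegnerHypothesis (W.conductorNorm ℤ) K) (hHp : SatisfiesHeegnerHypothesis p K)
    (hodd : Odd (NumberField.discr K)) (h3 : NumberField.discr K ≠ -3)
    (hirrK : (W.baseChange K).HasIrreducibleModPGaloisRep p)
    (ι : K →+* ℚ_[p]) (v vbar : HeightOneSpectrum (𝓞 K))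
    (hv : ∀ x : 𝓞 K, x ∈ v.asIdeal ↔ ‖ι (x : K)‖ < 1)
    (hvbar : ((p : ℕ) : 𝓞 K) ∈ vbar.asIdeal) (hne : vbar ≠ v)
    (κ : ZpExtension K p) (hκ : κ.IsAnticyclotomic)
    (γ : absoluteGaloisGroup K) [Fact (κ.IsTopGenerator γ)]
    {N : ℕ} [NeZero N] (Dt : ModularParametrizationData W N)
    (H : HeegnerDatum N (NumberField.discr K)) (ιC : K →+* ℂ) (P : (W.baseChange K).toAffine.Point)
    (hP : WeierstrassCurve.Affine.Point.map ιC.toRatAlgHom P = heegnerPointComplex Dt H)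
    (G : IwasawaAlgebra p) (hG : AcSelmer.XAc.charIdeal (W.baseChange K) p κ vbar ∅ γ = Ideal.span {G})
    (hG0 : PowerSeries.constantCoeff G ≠ 0) :
    ∃ n : ℕ, AcSelmer.XAc.HasCharValuationAt (W.baseChange K) p κ vbar ∅ γ n ∧
      2 * ((padicValInt p (1 - W.frobeniusTrace p + p) : ℤ) - 1 + padicLogOrd W p ι P) -
        2 * (padicValInt p Dt.c : ℤ) ≤ (n : ℤ) := by
  obtain ⟨htors, -⟩ :=
    h W p hp hord hirr K hK hHN hHp hodd h3 hirrK ι v vbar hv hvbar hne κ hκ γ N Dt H ιC P hP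
  exact ⟨(PowerSeries.constantCoeff G).valuation,
    AcSelmer.XAc.hasCharValuationAt_of_eq htors hG hG0 rfl,
    le_valuation_generator_constantCoeff_of_thm124a h hp hord hirr K hK hHN hHp hodd h3 hirrK ι v vbar
      hv hvbar hne κ hκ γ Dt H ιC P hP G hG hG0⟩

end Literature.NumberTheory.EllipticCurves.BurungaleCastellaSkinner2025

end
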